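import Summits.Ventures.PercRepro.RankLevelSetLevelFiveCqSixteen
import Summits.Ventures.PercRepro.S1RowEleven
import Summits.Ventures.PercRepro.S2FiveWindow
import Summits.Ventures.PercRepro.S2FourteenTwelve
import Summits.Ventures.PercRepro.S2FourteenThirteen
import Summits.Ventures.PercRepro.S2FourteenFourteen
import Summits.Ventures.PercRepro.S2FourteenFifteen
import Summits.Ventures.PercRepro.S2FourteenSixteen
import Summits.Ventures.PercRepro.S2FourteenSeventeen
import Summits.Ventures.PercRepro.S2FourteenEighteen

/-!
# PercRepro — S2: THEOREM C₅ AT `15` MODULO THE OPEN CELLS OF THE `p = 14` ROW (p7, gen 12; sub-claim S2)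

The `p = 14` row: corank `d ≤ 5` by the kit's reduction (`S2.rls_five_of_four_of_core`), `12 ≤ d ≤ 18` by the concentrated-tail cells of
this gen (S2FourteenTwelve … S2FourteenEighteen; `(14, 12)` through its double coloop split), `p ≥ 16` by `c025_five_large_sharp16`.
**`c025_five_large_sharp15_of_cells (hcells : the cells (14, 6 … 11) and (14, d ≥ 19)) (M) (p) (hp : 15 ≤ p) : RLS M p 5`** — C-025
at level `5` for every `p ≥ 15` MODULO those cells (priced OPEN at `(14, 6 … 11)` by 0.7–13.5 %; the cells `d ≥ 19` not typed — the
concentrated-tail generator reaches them, the key cell at `p = 14` is not priced). The window is NOT moved by this file. Axioms: standard.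
-/

open scoped Matroid

namespace PercRepro

namespace ThmN

variable {α : Type}

/-- The landed cells of the `p = 14` row, `12 ≤ d ≤ 18`, dispatched by `d`. -/
theorem c025_core_five_fourteen_xx (M : Matroid α) [M.Finite] (d : ℕ) (hd12 : 12 ≤ d) (hd18 : d ≤ 18)
    (hR : M.eRank = ((14 : ℕ) : ℕ∞)) (hn : M.E.ncard = 14 + d)
    (hfree : ∀ e ∈ M.E, ∃ A ⊆ M.E \ {e}, e ∉ M.closure A ∧ e ∉ M.closure ((M.E \ {e}) \ A)) : RLS M 14 5 := by
  interval_cases d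
  · exact c025_core_five_fourteen_twelve M hR hn hfree
  · exact c025_core_five_fourteen_thirteen M hR hn hfree
  · exact c025_core_five_fourteen_fourteen M hR hn hfree
  · exact c025_core_five_fourteen_fifteen M hR hn hfree
  · exact c025_core_five_fourteen_sixteen M hR hn hfree
  · exact c025_core_five_fourteen_seventeen M hR hn hfree
  · exact c025_core_five_fourteen_eighteen M hR hn hfree

/-- **The whole `p = 15` row for cores**: every `e`-free core of rank `15` on `> 20` points satisfies `RLS M 15 5` (the cells
`(15, 6 … 16)` and `c025_core_five_fifteen_ge_seventeen`). -/
theorem c025_core_five_fifteen_all (M : Matroid α) [M.Finite]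
    (hR : M.eRank = ((15 : ℕ) : ℕ∞)) (hbig : 15 + 5 < M.E.ncard)
    (hfree : ∀ e ∈ M.E, ∃ A ⊆ M.E \ {e}, e ∉ M.closure A ∧ e ∉ M.closure ((M.E \ {e}) \ A)) : RLS M 15 5 := by
  rcases Nat.lt_or_ge M.E.ncard (15 + 17) with h | h
  · have hn : M.E.ncard = 15 + (M.E.ncard - 15) := by omega
    have h6 : 6 ≤ M.E.ncard - 15 := by omega
    have h16 : M.E.ncard - 15 ≤ 16 := by omega
    generalize M.E.ncard - 15 = d at hn h6 h16
    interval_cases d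
    · exact c025_core_five_fifteen_six M hR hn hfree
    · exact c025_core_five_fifteen_seven M hR hn hfree
    · exact c025_core_five_fifteen_eight M hR hn hfree
    · exact c025_core_five_fifteen_nine M hR hn hfree
    · exact c025_core_five_fifteen_ten M hR hn hfree
    · exact c025_core_five_fifteen_eleven M hR hn hfree
    · exact c025_core_five_fifteen_twelve M hR hn hfree
    · exact c025_core_five_fifteen_thirteen M hR hn hfree
    · exact c025_core_five_fifteen_fourteen M hR hn hfree
    · exact c025_fifteen_fifteen M hR hn hfree
    · exact c025_core_five_fifteen_sixteen M hR hn hfree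
  · exact c025_core_five_fifteen_ge_seventeen M hR (by omega) hfree

/-- **THEOREM C₅ AT `15` MODULO THE OPEN CELLS** `(14, 6 … 11)` and `(14, d ≥ 19)`. -/
theorem c025_five_large_sharp15_of_cells
    (hcells : ∀ (M : Matroid α) [M.Finite] (d : ℕ), 6 ≤ d → (d ≤ 11 ∨ 19 ≤ d) → M.eRank = ((14 : ℕ) : ℕ∞) →
      M.E.ncard = 14 + d →
      (∀ e ∈ M.E, ∃ A ⊆ M.E \ {e}, e ∉ M.closure A ∧ e ∉ M.closure ((M.E \ {e}) \ A)) → RLS M 14 5)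
    (M : Matroid α) [M.Finite] (p : ℕ) (hp : 15 ≤ p) : RLS M p 5 := by
  rcases Nat.lt_or_ge p 16 with h15 | h16
  · have hp' : p = 15 := by omega
    subst hp'
    refine S2.rls_five_of_four_of_core 14 (by omega) (fun M _ p hp => S1.c025_four_eleven M p (by omega)) ?_ M 15 le_rfl
    intro M _ p hP' hR hbig hfree
    rcases Nat.lt_or_ge p 15 with h14 | h15'
    · have hp' : p = 14 := by omega
      subst hp'
      rcases Nat.lt_or_ge M.E.ncard (14 + 12) with h | h
      · have h6 : 6 ≤ M.E.ncard - 14 := by omega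
        have h11 : M.E.ncard - 14 ≤ 11 := by omega
        have hn : M.E.ncard = 14 + (M.E.ncard - 14) := by omega
        exact hcells M (M.E.ncard - 14) h6 (Or.inl h11) hR hn hfree
      · rcases Nat.lt_or_ge M.E.ncard (14 + 19) with h' | h'
        · exact c025_core_five_fourteen_xx M (M.E.ncard - 14) (by omega) (by omega) hR (by omega) hfree
        · have h6 : 6 ≤ M.E.ncard - 14 := by omega
          have h19 : 19 ≤ M.E.ncard - 14 := by omega
          have hn : M.E.ncard = 14 + (M.E.ncard - 14) := by omega
          exact hcells M (M.E.ncard - 14) h6 (Or.inr h19) hR hn hfree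
    · rcases Nat.lt_or_ge p 16 with h15'' | h16'
      · have hp' : p = 15 := by omega
        subst hp'
        exact c025_core_five_fifteen_all M hR hbig hfree
      · exact c025_five_large_sharp16 M p h16'
  · exact c025_five_large_sharp16 M p h16

end ThmN

end PercRepro
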